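import Mathlib
import HarnessLib
import Summits.Ventures.LatticeQCDFlow.Scoring.BatchMeansConsistency
import Summits.Ventures.LatticeQCDFlow.Scoring.BatchMeansVarianceEnvelope

/-!
# THE BATCH-MEANS ESTIMATOR OF THE ASYMPTOTIC VARIANCE IS CONSISTENT under a GEOMETRIC SUP-NORM
# ENVELOPE (every uniformly ergodic / Doeblin-power chain), from any initial law:
# `E_{μ₀}[(σ̂²_{a,b} − σ²_f)²] ≤ K/a + K'/b`

HONEST FRAMING: exact (Metropolis-corrected) sampling algorithms for lattice gauge theory;
figures of merit are autocorrelation/cost numbers at stated couplings and volumes; no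
continuum-physics claim.

Venture `LatticeQCDFlow` (cell pub-lqcd), topic `Scoring`; FANOUT row 8 (`s0-cpn-nemc`, GEN-20).
NEW WORK of the cell, not a published result; no definition is introduced; nothing is cited as a
fact.  Setting: `κ` a Markov kernel with invariant probability `π` and a GEOMETRIC SUP-NORM ENVELOPE
`|(kop κ)^[t] g (x) − ∫ g dπ| ≤ 2 C_g A ρ^t` for every bounded measurable `g` (`0 ≤ A`, `0 ≤ ρ < 1`)
— delivered by every one-step (`A = 1`, `ρ = 1 − ε`) or `m`-step Doeblin certificate
(`Scoring/DoeblinPowerGeometricEnvelope.lean`), i.e. by every uniformly ergodic kernel; `|f| ≤ C`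
measurable; `σ²_f = ∫ f̄² dπ + 2 Σ_{k≥1} ∫ f̄ (kop κ)^[k] f̄ dπ` the Green–Kubo variance; `P_{μ₀}` the
chain's path law from ANY initial law.  From a run of length `ab` form the `a ≥ 2` non-overlapping
batch means of length `b` and the batch-means estimator `σ̂²_{a,b} := ab · SE²_BM`
(`SE²_BM = replicaSEsq` of the batch means, `Scoring/BatchMeans.lean`).  THE THEOREM: there are
constants `K, K'` depending only on `C, A, ρ` such that for EVERY initial law, every `a ≥ 2`, `b ≥ 1`,
`E_{μ₀}[(σ̂²_{a,b} − σ²_f)²] ≤ K/a + K'/b`; hence `σ̂² → σ²_f` in probability as `a_n, b_n → ∞`.  This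
is GEN-19's `Scoring/BatchMeansConsistency.lean` (one-step minorisation) re-proved verbatim from the
envelope: `σ̂² = (a/(a−1))(V − W)`, `E[(V − E V)²] ≤ K₄/a + K₆/b`
(`Scoring/BatchMeansVarianceEnvelope.lean`), `|E V − σ²_f| ≤ θ² (2A/(1−ρ) + 4 + 4√b)/b` and
`E W² ≤ K₄/a²`, `0 ≤ σ²_f ≤ θ²` (`Scoring/GeometricEnvelopeBlockSumMoments.lean`, `θ = 4CA/(1−ρ)`).
The `m`-step Doeblin corollaries (the certificate shape of the cell's composite samplers) are
`Scoring/DoeblinPowerBatchMeans.lean`.  Printed counterparts NAMED ONLY: mean-square consistency of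
non-overlapping batch means (Glynn–Whitt 1991; Damerdji 1994; Flegal–Jones 2010).

## Content (hypotheses as above)

* **`chain_batchMeans_sigmaHat_mse_le_of_envelope`** — `∃ K K', ∀ μ₀, ∀ a ≥ 2, ∀ b ≥ 1,
  E_{μ₀}[(ab · SE²_BM − σ²_f)²] ≤ K/a + K'/b` (the proof's constants: `K = 32·512 θ⁴ + 16 θ⁴`,
  `K' = 16 K₆ + 32 θ⁴ ((2A/(1−ρ)+4)² + 16)`);
* **`chain_batchMeans_sigmaHat_tendstoInMeasure_of_envelope`** — for `a_n → ∞`, `b_n → ∞`: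
  `TendstoInMeasure P_{μ₀} (fun n x => σ̂²_{a_n,b_n}(x)) atTop (fun _ => σ²_f)`.

NOT CLAIMED: the optimal batch length or the sharp MSE rate; overlapping batch means; unbounded
observables; any `A, ρ` of a concrete sampler.
-/

noncomputable section

namespace Summit.Ventures.LatticeQCDFlow.Scoring

open MeasureTheory ProbabilityTheory Filter Finset Preorder Literature.Probability.MarkovChains
open scoped ENNReal Topology

variable {Ω : Type*} [MeasurableSpace Ω]

/-! ### Mean-square consistency -/

section Consistency

variable {κ : Kernel Ω Ω} [IsMarkovKernel κ] {π : Measure Ω} [IsProbabilityMeasure π] {A ρ : ℝ}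

/-- **MEAN-SQUARE CONSISTENCY OF THE BATCH-MEANS ESTIMATOR OF `σ²_f` UNDER A SUP-NORM ENVELOPE,
FROM ANY START.**  `π` invariant, `|(kop κ)^[t] g − πg| ≤ 2 C_g A ρ^t` for every bounded measurable
`g` (`0 ≤ A`, `0 ≤ ρ < 1`), `|f| ≤ C` measurable.  There are constants `K, K'` (depending on `C`, `A`,
`ρ` only) such that for EVERY initial law `μ₀`, every number of batches `a ≥ 2` and every batch
length `b ≥ 1`: `E_{μ₀}[(ab · SE²_BM − σ²_f)²] ≤ K/a + K'/b`. -/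
theorem chain_batchMeans_sigmaHat_mse_le_of_envelope (hπ : Kernel.Invariant κ π)
    (henv : ∀ (g : Ω → ℝ), Measurable g → ∀ (Cg : ℝ), (∀ x, |g x| ≤ Cg) →
      ∀ (t : ℕ) (x : Ω), |(kop κ)^[t] g x - ∫ y, g y ∂π| ≤ 2 * Cg * (A * ρ ^ t))
    (hA : 0 ≤ A) (hρ0 : 0 ≤ ρ) (hρ1 : ρ < 1)
    {f : Ω → ℝ} (hf : Measurable f) {C : ℝ} (hC : ∀ x, |f x| ≤ C) :
    ∃ K K' : ℝ, ∀ (μ₀ : Measure Ω) [IsProbabilityMeasure μ₀] (a b : ℕ), 2 ≤ a → b ≠ 0 →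
      ∫ x, (((b * a : ℕ) : ℝ)
          * replicaSEsq (fun j (x : ℕ → Ω) => (∑ i ∈ Finset.range b, f (x (b * j + i))) / b) a x
          - ((∫ y, (f y - ∫ z, f z ∂π) ^ 2 ∂π)
            + 2 * ∑' k, ∫ y, (f y - ∫ z, f z ∂π)
              * (kop κ)^[k + 1] (fun y => f y - ∫ z, f z ∂π) y ∂π)) ^ 2
        ∂(Kernel.trajMeasure (X := fun _ : ℕ => Ω) μ₀
          (fun n : ℕ => κ.comap (fun h : (i : ↥(Finset.Iic n)) → Ω => h ⟨n, Finset.mem_Iic.2 le_rfl⟩)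
            (measurable_pi_apply _)))
        ≤ K / a + K' / b := by
  have h1ρ : 0 < 1 - ρ := sub_pos.2 hρ1
  have h1ρ' : 1 - ρ ≠ 0 := h1ρ.ne'
  set c := ∫ z, f z ∂π with hc
  set σ2 := (∫ y, (f y - c) ^ 2 ∂π)
      + 2 * ∑' k, ∫ y, (f y - c) * (kop κ)^[k + 1] (fun y => f y - c) y ∂π with hσ2
  set θ : ℝ := 4 * C * A / (1 - ρ) with hθ
  set K4 : ℝ := 512 * θ ^ 4 with hK4
  set K6 : ℝ := 8 * (2 * C) ^ 2 * A ^ 2 * ((1 + ρ) / (1 - ρ) ^ 2) * (10 * θ ^ 2) * ((1 + ρ) / (1 - ρ)) with hK6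
  set σmax : ℝ := θ ^ 2 with hσmax
  have hσ0 : 0 ≤ σ2 := greenKubo_nonneg_of_envelope hπ henv hρ0 hρ1 hf hC
  have hσle : σ2 ≤ σmax := greenKubo_le_of_envelope hπ henv hρ0 hρ1 hf hC
  obtain ⟨hfb, hCfb, hfb0⟩ := centred_observable_bounds π hf hC
  have hC0 : 0 ≤ C := (abs_nonneg _).trans (hC (Classical.choice (nonempty_of_isProbabilityMeasure π)))
  refine ⟨32 * K4 + 16 * σmax ^ 2, 16 * K6 + 32 * θ ^ 4 * ((2 * A / (1 - ρ) + 4) ^ 2 + 16), ?_⟩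
  intro μ₀ hμ₀ a b ha hb
  set P := Kernel.trajMeasure (X := fun _ : ℕ => Ω) μ₀
      (fun n : ℕ => κ.comap (fun h : (i : ↥(Finset.Iic n)) → Ω => h ⟨n, Finset.mem_Iic.2 le_rfl⟩)
        (measurable_pi_apply _)) with hP
  have ha0 : a ≠ 0 := by omega
  have ha2 : (2 : ℝ) ≤ a := by exact_mod_cast ha
  have haR : (0 : ℝ) < a := by linarith
  have hbR : (0 : ℝ) < b := Nat.cast_pos.2 (Nat.pos_of_ne_zero hb)
  have hb1 : (1 : ℝ) ≤ b := Nat.one_le_cast.2 (Nat.pos_of_ne_zero hb)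
  -- the pieces `U j`, `V`, `EV`, `W`
  set U : ℕ → (ℕ → Ω) → ℝ := fun j x =>
    (∑ i ∈ Finset.range b, (f (x (b * j + i)) - c)) ^ 2 / b with hU
  set EV : ℝ := (∑ j ∈ Finset.range a, ∫ y, U j y ∂P) / a with hEV
  set r : ℝ := (a : ℝ) / ((a : ℝ) - 1) with hr
  have ha1 : (0 : ℝ) < (a : ℝ) - 1 := by linarith only [ha2]
  have hr1 : 1 ≤ r := by rw [hr, le_div_iff₀ ha1]; linarith only [ha2]
  have hr2 : r ≤ 2 := by rw [hr, div_le_iff₀ ha1]; linarith only [ha2]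
  have hr4 : r ^ 2 ≤ 4 := by nlinarith only [hr1, hr2]
  have hr12 : (r - 1) ^ 2 ≤ 4 / (a : ℝ) ^ 2 := by
    have hr' : r - 1 = 1 / ((a : ℝ) - 1) := by
      rw [hr]; field_simp; ring
    rw [hr', div_pow, one_pow, div_le_div_iff₀ (pow_pos ha1 2) (pow_pos haR 2)]
    nlinarith only [ha2]
  -- (1) the variance of `V`
  have hVar := chain_batchSq_mean_variance_le_of_envelope henv hρ0 hρ1 hf hC μ₀ ha0 hb
  rw [← hP] at hVar
  -- (2) the bias of `V`: `|EV − σ²| ≤ θ² (2/e + 4 + 4√b)/b`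
  have hbias : |EV - σ2| ≤ θ ^ 2 * (2 * A / (1 - ρ) + 4 + 4 * Real.sqrt b) / b := by
    have hj : ∀ j, |∫ y, U j y ∂P - σ2| ≤ θ ^ 2 * (2 * A / (1 - ρ) + 4 + 4 * Real.sqrt b) / b := by
      intro j
      have h := abs_chain_blockSum_sq_sub_le_of_envelope hπ henv hA hρ0 hρ1 hf hC μ₀ (b * j) b
      rw [← hP] at h
      have hUj : ∫ y, U j y ∂P = (∫ y, (∑ i ∈ Finset.range b, (f (y (b * j + i)) - c)) ^ 2 ∂P) / b :=
        integral_div _ _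
      rw [hUj, show (∫ y, (∑ i ∈ Finset.range b, (f (y (b * j + i)) - c)) ^ 2 ∂P) / (b : ℝ) - σ2
          = ((∫ y, (∑ i ∈ Finset.range b, (f (y (b * j + i)) - c)) ^ 2 ∂P) - b * σ2) / b by
            field_simp, abs_div, abs_of_pos hbR]
      exact div_le_div_of_nonneg_right h hbR.le
    have hsum : EV - σ2 = (∑ j ∈ Finset.range a, (∫ y, U j y ∂P - σ2)) / a := by
      rw [hEV, Finset.sum_sub_distrib, Finset.sum_const, Finset.card_range, nsmul_eq_mul]
      field_simp
    rw [hsum, abs_div, abs_of_pos haR, div_le_iff₀ haR]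
    calc |∑ j ∈ Finset.range a, (∫ y, U j y ∂P - σ2)|
        ≤ ∑ j ∈ Finset.range a, |∫ y, U j y ∂P - σ2| := Finset.abs_sum_le_sum_abs _ _
      _ ≤ ∑ j ∈ Finset.range a, θ ^ 2 * (2 * A / (1 - ρ) + 4 + 4 * Real.sqrt b) / b :=
          Finset.sum_le_sum fun j _ => hj j
      _ = θ ^ 2 * (2 * A / (1 - ρ) + 4 + 4 * Real.sqrt b) / b * a := by
          rw [Finset.sum_const, Finset.card_range, nsmul_eq_mul]; ring
  have hbias2 : (EV - σ2) ^ 2 ≤ 2 * θ ^ 4 * ((2 * A / (1 - ρ) + 4) ^ 2 + 16) / b := by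
    have h1 : (EV - σ2) ^ 2 ≤ (θ ^ 2 * (2 * A / (1 - ρ) + 4 + 4 * Real.sqrt b) / b) ^ 2 :=
      (sq_abs (EV - σ2)).symm.trans_le (pow_le_pow_left₀ (abs_nonneg _) hbias 2)
    refine h1.trans ?_
    have hsb : Real.sqrt b ^ 2 = b := Real.sq_sqrt hbR.le
    have hθ4 : 0 ≤ θ ^ 4 := by positivity
    have hsq2 : (2 * A / (1 - ρ) + 4 + 4 * Real.sqrt b) ^ 2 ≤ 2 * (2 * A / (1 - ρ) + 4) ^ 2 + 32 * b := by
      nlinarith only [sq_nonneg (2 * A / (1 - ρ) + 4 - 4 * Real.sqrt b), hsb]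
    have hp2 : (2 * A / (1 - ρ) + 4) ^ 2 / (b : ℝ) ^ 2 ≤ (2 * A / (1 - ρ) + 4) ^ 2 / b :=
      div_le_div_of_nonneg_left (sq_nonneg _) hbR (by nlinarith only [hb1])
    calc (θ ^ 2 * (2 * A / (1 - ρ) + 4 + 4 * Real.sqrt b) / b) ^ 2
        = θ ^ 4 * (2 * A / (1 - ρ) + 4 + 4 * Real.sqrt b) ^ 2 / (b : ℝ) ^ 2 := by ring
      _ ≤ θ ^ 4 * (2 * (2 * A / (1 - ρ) + 4) ^ 2 + 32 * b) / (b : ℝ) ^ 2 :=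
          div_le_div_of_nonneg_right (mul_le_mul_of_nonneg_left hsq2 hθ4) (sq_nonneg _)
      _ = 2 * θ ^ 4 * ((2 * A / (1 - ρ) + 4) ^ 2 / (b : ℝ) ^ 2) + 32 * θ ^ 4 / b := by
          field_simp
      _ ≤ 2 * θ ^ 4 * ((2 * A / (1 - ρ) + 4) ^ 2 / b) + 32 * θ ^ 4 / b := by
          have := mul_le_mul_of_nonneg_left hp2 (by positivity : (0 : ℝ) ≤ 2 * θ ^ 4)
          linarith only [this]
      _ = 2 * θ ^ 4 * ((2 * A / (1 - ρ) + 4) ^ 2 + 16) / b := by ring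
  -- (3) `E W² ≤ K₄/a²`
  have hT4 := chain_blockSum_fourth_le_of_envelope henv hρ0 hρ1 hf hC μ₀ 0
    (Nat.mul_ne_zero hb ha0)
  rw [← hP] at hT4
  simp only [zero_add] at hT4
  have hW : ∫ x, ((∑ n ∈ Finset.range (b * a), (f (x n) - c)) ^ 2 / ((b : ℝ) * (a : ℝ) ^ 2)) ^ 2 ∂P
      ≤ K4 / (a : ℝ) ^ 2 := by
    have hpt : ∀ x : ℕ → Ω, ((∑ n ∈ Finset.range (b * a), (f (x n) - c)) ^ 2 / ((b : ℝ) * (a : ℝ) ^ 2)) ^ 2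
        = (∑ n ∈ Finset.range (b * a), (f (x n) - c)) ^ 4 / (((b : ℝ) * (a : ℝ) ^ 2) ^ 2) := fun x => by
      rw [div_pow, ← pow_mul]
    rw [integral_congr_ae (ae_of_all _ hpt), integral_div]
    calc (∫ x, (∑ n ∈ Finset.range (b * a), (f (x n) - c)) ^ 4 ∂P) / (((b : ℝ) * (a : ℝ) ^ 2) ^ 2)
        ≤ (512 * (4 * C * A / (1 - ρ)) ^ 4 * ((b * a : ℕ) : ℝ) ^ 2) / (((b : ℝ) * (a : ℝ) ^ 2) ^ 2) :=
          div_le_div_of_nonneg_right hT4 (by positivity)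
      _ = K4 / (a : ℝ) ^ 2 := by
          rw [hK4, hθ]; push_cast; field_simp
  -- (4) pointwise decomposition and the elementary inequality
  have hdecomp : ∀ x : ℕ → Ω,
      ((b * a : ℕ) : ℝ) * replicaSEsq (fun j (x : ℕ → Ω) =>
          (∑ i ∈ Finset.range b, f (x (b * j + i))) / b) a x - σ2
        = r * ((∑ j ∈ Finset.range a, U j x) / a - EV) + r * (EV - σ2)
          + (-(r * ((∑ n ∈ Finset.range (b * a), (f (x n) - c)) ^ 2 / ((b : ℝ) * (a : ℝ) ^ 2))))
          + (r - 1) * σ2 := fun x => by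
    rw [batchMeans_sigmaHat_eq f c ha hb x]
    ring
  have hσ4 : σ2 ^ 2 ≤ σmax ^ 2 := pow_le_pow_left₀ hσ0 hσle 2
  have h4sq : ∀ p q u v : ℝ, (p + q + u + v) ^ 2 ≤ 4 * (p ^ 2 + q ^ 2 + u ^ 2 + v ^ 2) :=
    fun p q u v => by
      nlinarith only [sq_nonneg (p - q), sq_nonneg (p - u), sq_nonneg (p - v), sq_nonneg (q - u),
        sq_nonneg (q - v), sq_nonneg (u - v)]
  have hv4 : (r - 1) ^ 2 * σ2 ^ 2 ≤ 4 / (a : ℝ) ^ 2 * σmax ^ 2 :=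
    mul_le_mul hr12 hσ4 (sq_nonneg _) (by positivity)
  have hpt : ∀ x : ℕ → Ω,
      (((b * a : ℕ) : ℝ) * replicaSEsq (fun j (x : ℕ → Ω) =>
          (∑ i ∈ Finset.range b, f (x (b * j + i))) / b) a x - σ2) ^ 2
        ≤ 16 * ((∑ j ∈ Finset.range a, U j x) / a - EV) ^ 2 + 16 * (EV - σ2) ^ 2
          + 16 * ((∑ n ∈ Finset.range (b * a), (f (x n) - c)) ^ 2 / ((b : ℝ) * (a : ℝ) ^ 2)) ^ 2
          + 16 / (a : ℝ) ^ 2 * σmax ^ 2 := by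
    intro x
    have hX := mul_le_mul_of_nonneg_right hr4 (sq_nonneg ((∑ j ∈ Finset.range a, U j x) / a - EV))
    have hY := mul_le_mul_of_nonneg_right hr4 (sq_nonneg (EV - σ2))
    have hZ := mul_le_mul_of_nonneg_right hr4
      (sq_nonneg ((∑ n ∈ Finset.range (b * a), (f (x n) - c)) ^ 2 / ((b : ℝ) * (a : ℝ) ^ 2)))
    rw [hdecomp x]
    calc (r * ((∑ j ∈ Finset.range a, U j x) / a - EV) + r * (EV - σ2)
          + (-(r * ((∑ n ∈ Finset.range (b * a), (f (x n) - c)) ^ 2 / ((b : ℝ) * (a : ℝ) ^ 2))))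
          + (r - 1) * σ2) ^ 2
        ≤ 4 * ((r * ((∑ j ∈ Finset.range a, U j x) / a - EV)) ^ 2 + (r * (EV - σ2)) ^ 2
          + (-(r * ((∑ n ∈ Finset.range (b * a), (f (x n) - c)) ^ 2 / ((b : ℝ) * (a : ℝ) ^ 2)))) ^ 2
          + ((r - 1) * σ2) ^ 2) := h4sq _ _ _ _
      _ = 4 * (r ^ 2 * ((∑ j ∈ Finset.range a, U j x) / a - EV) ^ 2 + r ^ 2 * (EV - σ2) ^ 2
          + r ^ 2 * ((∑ n ∈ Finset.range (b * a), (f (x n) - c)) ^ 2 / ((b : ℝ) * (a : ℝ) ^ 2)) ^ 2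
          + (r - 1) ^ 2 * σ2 ^ 2) := by ring
      _ ≤ 4 * (4 * ((∑ j ∈ Finset.range a, U j x) / a - EV) ^ 2 + 4 * (EV - σ2) ^ 2
          + 4 * ((∑ n ∈ Finset.range (b * a), (f (x n) - c)) ^ 2 / ((b : ℝ) * (a : ℝ) ^ 2)) ^ 2
          + 4 / (a : ℝ) ^ 2 * σmax ^ 2) := by linarith only [hX, hY, hZ, hv4]
      _ = _ := by ring
  -- integrability of the right-hand side
  have hUm : ∀ j, Measurable (U j) := fun j => (batchSq_bounded_measurable hfb hCfb b j).1
  have hUb : ∀ j x, |U j x| ≤ (b * (2 * C)) ^ 2 / b := fun j x =>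
    (batchSq_bounded_measurable hfb hCfb b j).2 x
  have hVm : Measurable fun x : ℕ → Ω => (∑ j ∈ Finset.range a, U j x) / a - EV :=
    ((Finset.measurable_sum _ fun j _ => hUm j).div_const _).sub measurable_const
  have hVb : ∀ x : ℕ → Ω, |(∑ j ∈ Finset.range a, U j x) / a - EV|
      ≤ (a * ((b * (2 * C)) ^ 2 / b)) / a + |EV| := fun x => by
    refine (abs_sub _ _).trans (add_le_add ?_ le_rfl)
    rw [abs_div, Nat.abs_cast]
    refine div_le_div_of_nonneg_right ?_ haR.le
    exact (Finset.abs_sum_le_sum_abs _ _).trans ((Finset.sum_le_sum fun j _ => hUb j x).trans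
      (by rw [Finset.sum_const, Finset.card_range, nsmul_eq_mul]))
  have hiV2 : Integrable (fun x : ℕ → Ω => ((∑ j ∈ Finset.range a, U j x) / a - EV) ^ 2) P :=
    integrable_of_bounded P (hVm.pow_const 2) (C := ((a * ((b * (2 * C)) ^ 2 / b)) / a + |EV|) ^ 2)
      fun x => by rw [abs_pow]; exact pow_le_pow_left₀ (abs_nonneg _) (hVb x) 2
  have hTm : Measurable fun x : ℕ → Ω =>
      (∑ n ∈ Finset.range (b * a), (f (x n) - c)) ^ 2 / ((b : ℝ) * (a : ℝ) ^ 2) :=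
    ((Finset.measurable_sum _ fun n _ => hfb.comp (measurable_pi_apply _)).pow_const 2).div_const _
  have hTb : ∀ x : ℕ → Ω, |(∑ n ∈ Finset.range (b * a), (f (x n) - c)) ^ 2 / ((b : ℝ) * (a : ℝ) ^ 2)|
      ≤ ((b * a : ℕ) * (2 * C)) ^ 2 / ((b : ℝ) * (a : ℝ) ^ 2) := fun x => by
    rw [abs_div, abs_pow, abs_of_pos (by positivity : (0 : ℝ) < (b : ℝ) * (a : ℝ) ^ 2)]
    refine div_le_div_of_nonneg_right (pow_le_pow_left₀ (abs_nonneg _) ?_ 2) (by positivity)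
    exact (Finset.abs_sum_le_sum_abs _ _).trans ((Finset.sum_le_sum fun n _ => hCfb _).trans
      (by rw [Finset.sum_const, Finset.card_range, nsmul_eq_mul]))
  have hiW2 : Integrable (fun x : ℕ → Ω =>
      ((∑ n ∈ Finset.range (b * a), (f (x n) - c)) ^ 2 / ((b : ℝ) * (a : ℝ) ^ 2)) ^ 2) P :=
    integrable_of_bounded P (hTm.pow_const 2)
      (C := (((b * a : ℕ) * (2 * C)) ^ 2 / ((b : ℝ) * (a : ℝ) ^ 2)) ^ 2)
      fun x => by rw [abs_pow]; exact pow_le_pow_left₀ (abs_nonneg _) (hTb x) 2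
  have hiR : Integrable (fun x : ℕ → Ω =>
      16 * ((∑ j ∈ Finset.range a, U j x) / a - EV) ^ 2 + 16 * (EV - σ2) ^ 2
        + 16 * ((∑ n ∈ Finset.range (b * a), (f (x n) - c)) ^ 2 / ((b : ℝ) * (a : ℝ) ^ 2)) ^ 2
        + 16 / (a : ℝ) ^ 2 * σmax ^ 2) P :=
    (((hiV2.const_mul 16).add (integrable_const _)).add (hiW2.const_mul 16)).add (integrable_const _)
  -- integrate
  have hI1 : Integrable (fun x : ℕ → Ω =>
      16 * ((∑ j ∈ Finset.range a, U j x) / a - EV) ^ 2 + 16 * (EV - σ2) ^ 2) P :=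
    (hiV2.const_mul 16).add (integrable_const _)
  have hI2 : Integrable (fun x : ℕ → Ω =>
      16 * ((∑ j ∈ Finset.range a, U j x) / a - EV) ^ 2 + 16 * (EV - σ2) ^ 2
        + 16 * ((∑ n ∈ Finset.range (b * a), (f (x n) - c)) ^ 2 / ((b : ℝ) * (a : ℝ) ^ 2)) ^ 2) P :=
    hI1.add (hiW2.const_mul 16)
  calc ∫ x, (((b * a : ℕ) : ℝ) * replicaSEsq (fun j (x : ℕ → Ω) =>
          (∑ i ∈ Finset.range b, f (x (b * j + i))) / b) a x - σ2) ^ 2 ∂P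
      ≤ ∫ x, (16 * ((∑ j ∈ Finset.range a, U j x) / a - EV) ^ 2 + 16 * (EV - σ2) ^ 2
          + 16 * ((∑ n ∈ Finset.range (b * a), (f (x n) - c)) ^ 2 / ((b : ℝ) * (a : ℝ) ^ 2)) ^ 2
          + 16 / (a : ℝ) ^ 2 * σmax ^ 2) ∂P := by
        refine integral_mono_of_nonneg ?_ hiR (ae_of_all _ hpt)
        exact ae_of_all _ fun x => sq_nonneg _
    _ = 16 * ∫ x, ((∑ j ∈ Finset.range a, U j x) / a - EV) ^ 2 ∂P + 16 * (EV - σ2) ^ 2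
          + 16 * ∫ x, ((∑ n ∈ Finset.range (b * a), (f (x n) - c)) ^ 2 / ((b : ℝ) * (a : ℝ) ^ 2)) ^ 2 ∂P
          + 16 / (a : ℝ) ^ 2 * σmax ^ 2 := by
        have hE1 : ∫ x, 16 * ((∑ j ∈ Finset.range a, U j x) / a - EV) ^ 2 ∂P
            = 16 * ∫ x, ((∑ j ∈ Finset.range a, U j x) / a - EV) ^ 2 ∂P := integral_const_mul _ _
        have hE2 : ∫ x, 16 * ((∑ n ∈ Finset.range (b * a), (f (x n) - c)) ^ 2
            / ((b : ℝ) * (a : ℝ) ^ 2)) ^ 2 ∂P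
            = 16 * ∫ x, ((∑ n ∈ Finset.range (b * a), (f (x n) - c)) ^ 2
              / ((b : ℝ) * (a : ℝ) ^ 2)) ^ 2 ∂P := integral_const_mul _ _
        rw [integral_add hI2 (integrable_const _), integral_add hI1 (hiW2.const_mul 16),
          integral_add (hiV2.const_mul 16) (integrable_const _), hE1, hE2,
          integral_const, integral_const, probReal_univ, smul_eq_mul, smul_eq_mul, one_mul, one_mul]
    _ ≤ 16 * (K4 / a + K6 / b) + 16 * (2 * θ ^ 4 * ((2 * A / (1 - ρ) + 4) ^ 2 + 16) / b)
          + 16 * (K4 / (a : ℝ) ^ 2) + 16 / (a : ℝ) ^ 2 * σmax ^ 2 := by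
        have hV' : ∫ x, ((∑ j ∈ Finset.range a, U j x) / a - EV) ^ 2 ∂P ≤ K4 / a + K6 / b := by
          refine hVar.trans (le_of_eq ?_)
          rw [hK4, hK6, hθ]
        linarith only [hV', hbias2, hW]
    _ ≤ (32 * K4 + 16 * σmax ^ 2) / a + (16 * K6 + 32 * θ ^ 4 * ((2 * A / (1 - ρ) + 4) ^ 2 + 16)) / b := by
        have hK40 : 0 ≤ K4 := by positivity
        have hs0 : 0 ≤ σmax ^ 2 := sq_nonneg _
        have ha1' : (1 : ℝ) ≤ a := by linarith only [ha2]
        have h1 : K4 / (a : ℝ) ^ 2 ≤ K4 / a :=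
          div_le_div_of_nonneg_left hK40 haR (by nlinarith only [ha1'])
        have h2 : 16 / (a : ℝ) ^ 2 * σmax ^ 2 ≤ 16 * σmax ^ 2 / a := by
          rw [div_mul_eq_mul_div]
          exact div_le_div_of_nonneg_left (by positivity) haR (by nlinarith only [ha1'])
        have hsplit : (32 * K4 + 16 * σmax ^ 2) / (a : ℝ)
            = 16 * (K4 / a) + 16 * (K4 / a) + 16 * σmax ^ 2 / a := by
          field_simp; ring
        have hsplit' : (16 * K6 + 32 * θ ^ 4 * ((2 * A / (1 - ρ) + 4) ^ 2 + 16)) / (b : ℝ)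
            = 16 * (K6 / b) + 16 * (2 * θ ^ 4 * ((2 * A / (1 - ρ) + 4) ^ 2 + 16) / b) := by
          field_simp; ring
        rw [hsplit, hsplit']
        linarith only [h1, h2]

/-- **CONVERGENCE IN PROBABILITY OF THE BATCH-MEANS ESTIMATOR.**  Under the same hypotheses, for
any numbers of batches `a_n → ∞` and batch lengths `b_n → ∞` and EVERY initial law `μ₀`:
`TendstoInMeasure P_{μ₀} (fun n x => a_n b_n · SE²_BM(x; a_n, b_n)) atTop (fun _ => σ²_f)`. -/
theorem chain_batchMeans_sigmaHat_tendstoInMeasure_of_envelope (hπ : Kernel.Invariant κ π)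
    (henv : ∀ (g : Ω → ℝ), Measurable g → ∀ (Cg : ℝ), (∀ x, |g x| ≤ Cg) →
      ∀ (t : ℕ) (x : Ω), |(kop κ)^[t] g x - ∫ y, g y ∂π| ≤ 2 * Cg * (A * ρ ^ t))
    (hA : 0 ≤ A) (hρ0 : 0 ≤ ρ) (hρ1 : ρ < 1)
    {f : Ω → ℝ} (hf : Measurable f) {C : ℝ} (hC : ∀ x, |f x| ≤ C)
    (μ₀ : Measure Ω) [IsProbabilityMeasure μ₀] {a b : ℕ → ℕ} (ha : Tendsto a atTop atTop)
    (hb : Tendsto b atTop atTop) :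
    TendstoInMeasure (Kernel.trajMeasure (X := fun _ : ℕ => Ω) μ₀
        (fun n : ℕ => κ.comap (fun h : (i : ↥(Finset.Iic n)) → Ω => h ⟨n, Finset.mem_Iic.2 le_rfl⟩)
          (measurable_pi_apply _)))
      (fun (n : ℕ) (x : ℕ → Ω) => ((b n * a n : ℕ) : ℝ)
        * replicaSEsq (fun j (x : ℕ → Ω) => (∑ i ∈ Finset.range (b n), f (x (b n * j + i))) / (b n))
          (a n) x)
      atTop (fun _ => (∫ y, (f y - ∫ z, f z ∂π) ^ 2 ∂π)
        + 2 * ∑' k, ∫ y, (f y - ∫ z, f z ∂π) * (kop κ)^[k + 1] (fun y => f y - ∫ z, f z ∂π) y ∂π) := by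
  set P := Kernel.trajMeasure (X := fun _ : ℕ => Ω) μ₀
      (fun n : ℕ => κ.comap (fun h : (i : ↥(Finset.Iic n)) → Ω => h ⟨n, Finset.mem_Iic.2 le_rfl⟩)
        (measurable_pi_apply _)) with hP
  set c := ∫ z, f z ∂π with hc
  set σ2 := (∫ y, (f y - c) ^ 2 ∂π)
      + 2 * ∑' k, ∫ y, (f y - c) * (kop κ)^[k + 1] (fun y => f y - c) y ∂π with hσ2
  obtain ⟨K, K', hAB⟩ := chain_batchMeans_sigmaHat_mse_le_of_envelope hπ henv hA hρ0 hρ1 hf hC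
  obtain ⟨hfb, hCfb, -⟩ := centred_observable_bounds π hf hC
  -- the statistic is measurable and bounded, so the squared error is integrable
  have hstat_m : ∀ n, Measurable fun x : ℕ → Ω => ((b n * a n : ℕ) : ℝ)
      * replicaSEsq (fun j (x : ℕ → Ω) => (∑ i ∈ Finset.range (b n), f (x (b n * j + i))) / (b n))
        (a n) x := fun n => measurable_batchMeans_sigmaHat hf (a n) (b n)
  rw [tendstoInMeasure_iff_measureReal_norm]
  intro δ hδ
  -- eventually `a n ≥ 2` and `b n ≥ 1`
  have hev : ∀ᶠ n in atTop, 2 ≤ a n ∧ b n ≠ 0 := by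
    filter_upwards [ha.eventually_ge_atTop 2, hb.eventually_ge_atTop 1] with n h1 h2
    exact ⟨h1, by omega⟩
  have hA_t : Tendsto (fun n : ℕ => (K / (a n : ℝ) + K' / (b n : ℝ)) / δ ^ 2) atTop (𝓝 0) := by
    have h1 : Tendsto (fun n : ℕ => K / (a n : ℝ)) atTop (𝓝 0) :=
      tendsto_const_nhds.div_atTop ((tendsto_natCast_atTop_atTop (R := ℝ)).comp ha)
    have h2 : Tendsto (fun n : ℕ => K' / (b n : ℝ)) atTop (𝓝 0) :=
      tendsto_const_nhds.div_atTop ((tendsto_natCast_atTop_atTop (R := ℝ)).comp hb)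
    simpa using (h1.add h2).div_const (δ ^ 2)
  refine squeeze_zero' (Eventually.of_forall fun n => measureReal_nonneg) ?_ hA_t
  filter_upwards [hev] with n hn
  have hmse := hAB μ₀ (a n) (b n) hn.1 hn.2
  rw [← hP] at hmse
  -- Chebyshev on the squared error
  set D : (ℕ → Ω) → ℝ := fun x => ((b n * a n : ℕ) : ℝ)
      * replicaSEsq (fun j (x : ℕ → Ω) => (∑ i ∈ Finset.range (b n), f (x (b n * j + i))) / (b n))
        (a n) x - σ2 with hD
  have hDm : Measurable D := (hstat_m n).sub measurable_const
  have hset : {x : ℕ → Ω | δ ≤ ‖((b n * a n : ℕ) : ℝ)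
      * replicaSEsq (fun j (x : ℕ → Ω) => (∑ i ∈ Finset.range (b n), f (x (b n * j + i))) / (b n))
        (a n) x - σ2‖} = {x | δ ^ 2 ≤ D x ^ 2} := by
    ext x
    simp only [Set.mem_setOf_eq, Real.norm_eq_abs]
    constructor
    · intro h
      calc δ ^ 2 ≤ |D x| ^ 2 := pow_le_pow_left₀ hδ.le h 2
        _ = D x ^ 2 := sq_abs _
    · intro h
      have := Real.sqrt_le_sqrt h
      rw [Real.sqrt_sq hδ.le, Real.sqrt_sq_eq_abs] at this
      exact this
  rw [hset]
  -- integrability of `D²`: the statistic is bounded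
  have hiD2 : Integrable (fun x => D x ^ 2) P :=
    integrable_of_bounded P (hDm.pow_const 2) (C := (4 * (b n) * C ^ 2 + |σ2|) ^ 2) fun x => by
      rw [abs_pow]
      refine pow_le_pow_left₀ (abs_nonneg _) ((abs_sub _ _).trans (add_le_add ?_ le_rfl)) 2
      exact abs_batchMeans_sigmaHat_le hC hn.1 hn.2 x
  have hcheb := mul_meas_ge_le_integral_of_nonneg (μ := P) (ae_of_all _ fun x => sq_nonneg (D x))
    hiD2 (δ ^ 2)
  have hδ2 : 0 < δ ^ 2 := by positivity
  calc P.real {x | δ ^ 2 ≤ D x ^ 2} ≤ (∫ x, D x ^ 2 ∂P) / δ ^ 2 := by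
        rw [le_div_iff₀ hδ2, mul_comm]; exact hcheb
    _ ≤ (K / (a n : ℝ) + K' / (b n : ℝ)) / δ ^ 2 := div_le_div_of_nonneg_right hmse hδ2.le

end Consistency

end Summit.Ventures.LatticeQCDFlow.Scoring

end
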